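import Mathlib
import Literature.MathematicalPhysics.QuantumFieldTheory.Balaban1983to89.Step

/-!
# `Balaban1983to89.B12Beta` — [Balaban1987RG1] §1 (1.20)–(1.22): the β-functions as second moments of the
vacuum-polarization kernel, and the PRINTED ONE-LOOP SPLIT of β ((1.3) vs (1.6), (2.12)–(2.14) p. 268)

CITATION HEADER (lean-in-tree rule 2026-08-18).  Source: T. Bałaban, *Renormalization group approach to lattice gauge
field theories. I. Generation of effective actions in a small field approximation and a coupling constant
renormalization in four dimensions*, Commun. Math. Phys. **109**, 249–301 (1987), doi:10.1007/bf01215223 (held: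
`paper:balaban1987-cmp109-rg-i-small-field`; journal page = PDF page + 248; every formula below was read from the page
renders, not from the OCR layer).  Locators: (1.3) p. 260, (1.6)–(1.7) p. 261, (1.20)–(1.22) and the β-clause p. 264,
Theorem 3 p. 264, (2.12)–(2.15) p. 268, (5.37)–(5.44) pp. 297–298.

WHAT THIS MODULE DOES (audit cell `pub-balaban`, paper sub-cell B12, phase-2 row P12a, unit `b2b-balaban-b12`).
Value = typed skeleton + kernel-checked bookkeeping, NOT summit progress; nothing of the series is asserted.

* Part 1 — (1.20)–(1.22) VERBATIM SHAPE.  After the infinite-volume limit `T^{(j+1)} ↗ ℤ^d` (p. 264) the vacuum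
  polarization tensor is a real kernel `Π_{j+1,μν}(g_j, x)` on `ℤ^d` ((1.21): colour structure `δ^{ab}`, translation
  invariance, Euclidean covariance), and (1.22) DEFINES `β_{j+1}(g_j) := Σ_x Π_{j+1,μν}(g_j,x) x_μ x_ν` "for μ, ν
  arbitrary, μ ≠ ν".  Typed here over an ABSTRACT kernel `Fin d → Fin d → (Fin d → ℤ) → ℝ` (the coupling/history
  argument suppressed: one kernel per scale and history): `secondMoment` = the right member of (1.22); `PermCovariant` =
  the second line of (1.21) for the lattice rotations that are coordinate permutations; `secondMoment_pair_indep` =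
  the kernel-checked content of "for μ, ν arbitrary, μ ≠ ν" (the number does not depend on the pair).  The first
  equality of (1.22) (`−∂²Π̃/∂p_μ∂p_ν (0) = Σ_x Π(x) x_μ x_ν`, with `Π̃(p) = Σ_x e^{−ipx} Π(x)`) is a sign convention
  checked by hand in GAPS C-b12-1 and not typed (no lattice Fourier transform is set up in this package).

* Part 2 — THE PRINTED ONE-LOOP SPLIT (located refinement of the cell's missing input (β-AF) = `Step.BetaLower b γ β`,
  `b > 0`, GAPS G1/G-f2.2/G-strat-1, MISSING.md §A1).  (1.3) p. 260 writes the effective action with the zeroth-order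
  term `[log Z^{(j)}(U_k) − log Z^{(j)}(1)]` SEPARATE from `[E^{(j+1)}(g_j,U_k) − E^{(j+1)}(g_j,1)]`; (1.6) p. 261
  ("it is not necessary to separate the terms of zeroth order from the remaining terms") MERGES them into one symbol
  `E^{(j+1)}`; p. 264: the β-functions "are determined by the functions E^{(j+1)}(g_j,U_{j+1}) in (1.6)" — i.e. by the
  MERGED function; (2.12)–(2.14) p. 268 exhibit, at step k+1, `log Z^{(k)}(U_{k+1})` (a Gaussian normalisation whose
  covariance `C^{(k)}(U_{k+1}) = (C*Δ^{(k)}(U_{k+1})C)^{-1}` involves NO coupling constant) plus the remainder (2.13), of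
  which the text says "the expression under the exponential above vanishes at g_k = 0" (so (2.13) ≡ 0 at g_k = 0, the
  restriction χ_k of (2.9) being void there).  Consequently — this is bookkeeping on the printed formulas, not a quoted
  sentence — `β_{k+1}(g_0,…,g_k) = β⁰_{k+1} + β¹_{k+1}(g_0,…,g_k)` with `β⁰_{k+1}` (second moment of the polarization of
  `log Z^{(k)}`, the ONE-LOOP coefficient of the scheme at scale k+1) INDEPENDENT OF ALL COUPLINGS and `β¹_{k+1} = 0`
  at `g_k = 0`.  `OneLoopSplit` types exactly this; `betaLowerHist_of_split` / `betaLower_of_split` are the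
  kernel-checked arithmetic: (β-AF) follows from (AF-0) `inf_k β⁰_k > 0` (one-loop lattice asymptotic freedom of
  Bałaban's block-averaging scheme, UNIFORMLY in the scale — "second order perturbative calculations",
  [Balaban1989LargeFieldII] p. 355; NOT printed anywhere in the series) and (AF-1) `|β¹_{k+1}| ≤ C·g_k` uniformly in k
  and in the history (which is where the p. 264 clause "uniformly bounded … together with all derivatives" would enter:
  `af1_of_vanish_lipschitz`; its proof is NOT printed — GAPS G-b12-2), for `γ ≤ b/C`.  `thm2Conclusion_of_split` chains
  this with `Step.couplingTrajectory_exists` (Markov typing) to the conclusion of [Balaban1987RG1] Theorem 2 in the form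
  `Step.Discrete031`.  The history-dependent typing `(k : ℕ) → (Fin (k+1) → ℝ) → ℝ` of Part 2 is the one of GAPS
  G-ref2-1/G-adv2-4 (p. 298: "β_j depends also on all preceding coupling constants"); the forward-shooting existence
  theorem for it is unit `b2b-balaban-strat-b12`'s `FlowStep` module and is not duplicated here.

Companion prose: `run/shared/lean/pub/pub-balaban/GAPS.md` rows C-b12-1, G-b12-1, G-b12-2; `DIVERGENCE.md` D-b12-1..3;
render transcript `run/shared/lean/pub/pub-balaban/b2b-balaban-b12/transcript-B12-sec2-5.md`.
-/

namespace Literature.MathematicalPhysics.QuantumFieldTheory.Balaban1983to89.B12Beta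

open Literature.MathematicalPhysics.QuantumFieldTheory.Balaban1983to89

/-! ## Part 1 — (1.20)–(1.22): β as the second moment of the vacuum-polarization kernel -/

/-- (1.21) p. 264, after the limit `T^{(j+1)} ↗ ℤ^d`: "Π^{ab}_{j+1,μν}(g_j,x,x') = δ^{ab} Π_{j+1,μν}(g_j, x − x'), …
where Π_{j+1,μν}(g_j,x) is a real valued function".  The real kernel on `ℤ^d`, indices `μ ν : Fin d`, the arguments
`j`, `g_j` (and the history) suppressed: one such kernel per scale and history. [cite: Balaban1987RG1, (1.21) p.264] -/
abbrev Kernel (d : ℕ) : Type := Fin d → Fin d → (Fin d → ℤ) → ℝ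

/-- (1.22) p. 264, right member, verbatim: "β_{j+1}(g_j) = −(∂²/∂p_μ∂p_ν Π̃_{j+1,μν})(g_j,0) = Σ_x Π_{j+1,μν}(g_j,x) x_μ x_ν
for μ, ν arbitrary, μ ≠ ν, where f̃(p) denotes the Fourier transform of the function f(x), x ∈ ℤ^d."  Typed as the
lattice sum (a `tsum`; its convergence is the exponential decay (5.10) p. 292 / (5.44) p. 298 of the kernel, typed in the
§5 block of `B12.lean`, not here). Also (5.42) p. 297: "the fundamental equality defining the β-function". [cite: Balaban1987RG1, (1.22) p.264] -/
noncomputable def secondMoment {d : ℕ} (P : Kernel d) (μ ν : Fin d) : ℝ :=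
  ∑' x : Fin d → ℤ, P μ ν x * (x μ : ℝ) * (x ν : ℝ)

/-- (1.21) p. 264, second line: "Π_{j+1}(g_j, rb, rb') = Π_{j+1}(g_j, b, b'), … r is a Euclidean rotation leaving the
lattice T^{(j+1)} invariant", specialised to the rotations permuting the coordinate axes (`σ : Equiv.Perm (Fin d)`,
acting on sites by `x ↦ x ∘ σ⁻¹` and on directions by `μ ↦ σ μ`); reflections are not needed below.
[cite: Balaban1987RG1, (1.21) p.264] -/
def PermCovariant {d : ℕ} (P : Kernel d) : Prop :=
  ∀ (σ : Equiv.Perm (Fin d)) (μ ν : Fin d) (x : Fin d → ℤ), P (σ μ) (σ ν) (x ∘ σ.symm) = P μ ν x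

/-- The content of "for μ, ν arbitrary, μ ≠ ν" in (1.22) p. 264: under the covariance (1.21) the second moment
`Σ_x Π_{μν}(x) x_μ x_ν` is the same number for every pair `μ ≠ ν` (no summability needed: re-indexing a `tsum` by a
lattice automorphism).  [cite: Balaban1987RG1, (1.22) p.264] -/
theorem secondMoment_pair_indep {d : ℕ} {P : Kernel d} (hP : PermCovariant P) {μ ν μ' ν' : Fin d}
    (h : μ ≠ ν) (h' : μ' ≠ ν') : secondMoment P μ' ν' = secondMoment P μ ν := by
  -- a coordinate permutation with σ μ = μ', σ ν = ν'
  obtain ⟨σ, hσμ, hσν⟩ : ∃ σ : Equiv.Perm (Fin d), σ μ = μ' ∧ σ ν = ν' := by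
    let σ₁ : Equiv.Perm (Fin d) := Equiv.swap μ μ'
    have h1 : σ₁ μ = μ' := Equiv.swap_apply_left μ μ'
    have hne : σ₁ ν ≠ μ' := by
      intro hc
      rw [← h1] at hc
      exact h (σ₁.injective hc).symm
    let σ₂ : Equiv.Perm (Fin d) := Equiv.swap (σ₁ ν) ν'
    refine ⟨σ₁.trans σ₂, ?_, ?_⟩
    · show σ₂ (σ₁ μ) = μ'
      rw [h1]
      exact Equiv.swap_apply_of_ne_of_ne hne.symm h'
    · show σ₂ (σ₁ ν) = ν'
      exact Equiv.swap_apply_left _ _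
  subst hσμ hσν
  -- re-index the lattice sum by x ↦ x ∘ σ⁻¹
  let e : (Fin d → ℤ) ≃ (Fin d → ℤ) := Equiv.arrowCongr σ (Equiv.refl ℤ)
  have he : ∀ (y : Fin d → ℤ) (i : Fin d), e y i = y (σ.symm i) := fun y i => rfl
  unfold secondMoment
  calc ∑' x : Fin d → ℤ, P (σ μ) (σ ν) x * (x (σ μ) : ℝ) * (x (σ ν) : ℝ)
      = ∑' y : Fin d → ℤ, P (σ μ) (σ ν) (e y) * ((e y) (σ μ) : ℝ) * ((e y) (σ ν) : ℝ) :=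
        (Equiv.tsum_eq e (fun x : Fin d → ℤ => P (σ μ) (σ ν) x * (x (σ μ) : ℝ) * (x (σ ν) : ℝ))).symm
    _ = ∑' y : Fin d → ℤ, P μ ν y * (y μ : ℝ) * (y ν : ℝ) := by
        refine tsum_congr fun y => ?_
        have hey : e y = y ∘ σ.symm := funext (he y)
        rw [hey, hP σ μ ν y]
        simp [Function.comp, Equiv.symm_apply_apply]

/-! ## Part 2 — the printed one-loop split and the arithmetic of (β-AF)

History-dependent typing (p. 298 "β_j depends also on all preceding coupling constants"; GAPS G-ref2-1/G-adv2-4):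
`β k p` is `β_{k+1}` evaluated at the history `p = (g_0, …, g_k) : Fin (k+1) → ℝ`; `p (Fin.last k) = g_k`. -/

/-- Histories with every entry in ]0,γ] (Theorem 3 p. 264: "0 < g_k ≤ γ for k = 0,1,…,K"). [cite: Balaban1987RG1, Thm 3 p.264] -/
def HistBox (γ : ℝ) (k : ℕ) : Set (Fin (k + 1) → ℝ) := {p | ∀ i, 0 < p i ∧ p i ≤ γ}

/-- THE PRINTED ONE-LOOP SPLIT of the β-functions, as bookkeeping on (1.3)/(1.6) pp. 260–261, p. 264 ("determined by the
functions E^{(j+1)} in (1.6)") and (2.12)–(2.14) p. 268: `β_{k+1}(g_0,…,g_k) = β⁰_{k+1} + β¹_{k+1}(g_0,…,g_k)`, where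
`β⁰_{k+1}` — the second moment (1.22) of the polarization of `U ↦ log Z^{(k)}(U)`, a Gaussian normalisation with
coupling-free covariance `(C*Δ^{(k)}(U)C)^{-1}` — depends on NO coupling constant, and `β¹_{k+1}`, coming from (2.13),
VANISHES at `g_k = 0` ("the expression under the exponential above vanishes at g_k = 0", p. 268; χ_k of (2.9) is void
there).  Fields: `β0 k` = `β⁰_{k+1}`, a NUMBER per scale (no coupling dependence, by typing); `β1 k p` =
`β¹_{k+1}(g_0,…,g_k)`, the contribution of the remainder (2.13); `split` = (1.6)/(1.20): β is computed from the MERGED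
`E^{(k+1)} = log Z^{(k)} + (2.13)` and (1.22) is additive in the kernel; `vanish` = p. 268: (2.13) vanishes identically
at `g_k = 0`, hence so do its polarization kernel and its second moment.  A structure of HYPOTHESES about an abstract
history-dependent family `β`; nothing asserted. [cite: Balaban1987RG1, (2.12)–(2.14) p.268] -/
structure OneLoopSplit (β : (k : ℕ) → (Fin (k + 1) → ℝ) → ℝ) where
  β0 : ℕ → ℝ
  β1 : (k : ℕ) → (Fin (k + 1) → ℝ) → ℝ
  split : ∀ k p, β k p = β0 k + β1 k p
  vanish : ∀ k (p : Fin (k + 1) → ℝ), p (Fin.last k) = 0 → β1 k p = 0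

/-- (AF-1) from the printed vanishing plus a derivative bound.  If `β¹_{k+1}` is Lipschitz in its LAST argument on
`[0,γ]` with a constant `C` uniform in the scale and the history — the history-uniform reading of the p. 264 clause
"uniformly bounded on this interval together with all derivatives", whose proof is NOT printed (GAPS G-b12-2) — then
`|β¹_{k+1}(g_0,…,g_k)| ≤ C g_k` on histories in ]0,γ]. [cite: Balaban1987RG1, §1 p.264] -/
theorem af1_of_vanish_lipschitz {β : (k : ℕ) → (Fin (k + 1) → ℝ) → ℝ} (S : OneLoopSplit β) {C γ : ℝ}
    (hLip : ∀ k (p : Fin (k + 1) → ℝ), p ∈ HistBox γ k →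
      |S.β1 k p - S.β1 k (Function.update p (Fin.last k) 0)| ≤ C * p (Fin.last k)) :
    ∀ k (p : Fin (k + 1) → ℝ), p ∈ HistBox γ k → |S.β1 k p| ≤ C * p (Fin.last k) := by
  intro k p hp
  have h0 : S.β1 k (Function.update p (Fin.last k) 0) = 0 :=
    S.vanish k _ (by simp)
  simpa [h0] using hLip k p hp

/-- (β-AF) ⇐ (AF-0) + (AF-1), history-dependent form: if `2b ≤ β⁰_{k+1}` for all k (one-loop asymptotic freedom of the
scheme, uniform in the scale), `|β¹_{k+1}| ≤ C g_k` on histories in ]0,γ] (uniform remainder) and `C γ ≤ b`, then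
`b ≤ β_{k+1}(g_0,…,g_k)` on every history in ]0,γ].  Elementary; the two hypotheses are exactly the unprinted inputs
located in GAPS G-b12-1. [folklore] -/
theorem betaLowerHist_of_split {β : (k : ℕ) → (Fin (k + 1) → ℝ) → ℝ} (S : OneLoopSplit β) {b C γ : ℝ}
    (hAF0 : ∀ k, 2 * b ≤ S.β0 k)
    (hAF1 : ∀ k (p : Fin (k + 1) → ℝ), p ∈ HistBox γ k → |S.β1 k p| ≤ C * p (Fin.last k))
    (hC : 0 ≤ C) (hγ : C * γ ≤ b) :
    ∀ k (p : Fin (k + 1) → ℝ), p ∈ HistBox γ k → b ≤ β k p := by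
  intro k p hp
  have h1 := hAF1 k p hp
  have hlast : p (Fin.last k) ≤ γ := (hp (Fin.last k)).2
  have h2 : C * p (Fin.last k) ≤ C * γ := mul_le_mul_of_nonneg_left hlast hC
  have h3 : -(C * p (Fin.last k)) ≤ S.β1 k p := (abs_le.mp h1).1
  rw [S.split k p]
  linarith [hAF0 k]

/-- The same arithmetic in the MARKOV typing of `Step.RGEq` (β_{j} a function of the previous coupling only, as printed
in (0.18)/(0.20)/(2.15)): a family `βM j x = β⁰_j + r_j(x)` with `2b ≤ β⁰_j` and `|r_j(x)| ≤ C x` on ]0,γ], `C γ ≤ b`,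
satisfies `Step.BetaLower b γ βM`. [folklore] -/
theorem betaLower_of_split (βM : ℕ → ℝ → ℝ) (β0 : ℕ → ℝ) (r : ℕ → ℝ → ℝ) {b C γ : ℝ}
    (hsplit : ∀ j x, βM j x = β0 j + r j x) (hAF0 : ∀ j, 2 * b ≤ β0 j)
    (hAF1 : ∀ j x, 0 < x → x ≤ γ → |r j x| ≤ C * x) (hC : 0 ≤ C) (hγ : C * γ ≤ b) :
    Step.BetaLower b γ βM := by
  intro j x hx hxγ
  have h1 := hAF1 j x hx hxγ
  have h2 : C * x ≤ C * γ := mul_le_mul_of_nonneg_left hxγ hC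
  have h3 : -(C * x) ≤ r j x := (abs_le.mp h1).1
  rw [hsplit j x]
  linarith [hAF0 j]

/-- End to end, Markov typing: the one-loop split with (AF-0), (AF-1), an upper bound `β⁰_j + r_j ≤ β'` and continuity
of the `r_j` on ]0,γ] yield the CONCLUSION of [Balaban1987RG1] Theorem 2 as typed in `Step` — for every `K` and every
renormalised coupling `0 < g ≤ γ` a trajectory `(g_k)_{k ≤ K} ⊂ ]0,γ]` solving (0.20) with `g_K = g` and the two-sided
running (0.31) in the form `Step.Discrete031 b β'` — via `Step.couplingTrajectory_exists` (backward construction).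
This does NOT prove Theorem 2: (AF-0), (AF-1), the upper bound and the continuity are hypotheses whose proofs are not
in print (GAPS G-b12-1, G-b12-2), and the printed β is history-dependent (G-adv2-4). [cite: Balaban1987RG1, Thm 2 p.259] -/
theorem thm2Conclusion_of_split (βM : ℕ → ℝ → ℝ) (β0 : ℕ → ℝ) (r : ℕ → ℝ → ℝ) {b C γ β' : ℝ}
    (hγ0 : 0 < γ) (hb : 0 < b)
    (hsplit : ∀ j x, βM j x = β0 j + r j x) (hAF0 : ∀ j, 2 * b ≤ β0 j)
    (hAF1 : ∀ j x, 0 < x → x ≤ γ → |r j x| ≤ C * x) (hC : 0 ≤ C) (hγ : C * γ ≤ b)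
    (hU : Step.BetaUpper β' γ βM) (hcont : ∀ j, ContinuousOn (r j) (Set.Ioc 0 γ)) :
    ∀ (K : ℕ) (g : ℝ), 0 < g → g ≤ γ →
      ∃ gs : ℕ → ℝ, gs K = g ∧ Step.RGEq K βM gs ∧ Step.InInterval γ K gs ∧ Step.Discrete031 b β' K g gs := by
  have hL : Step.BetaLower b γ βM := betaLower_of_split βM β0 r hsplit hAF0 hAF1 hC hγ
  have hbβ : b ≤ β' := by
    have h1 := hL 0 γ hγ0 le_rfl
    have h2 := hU 0 γ hγ0 le_rfl
    linarith
  have hcontM : ∀ j, ContinuousOn (βM j) (Set.Ioc 0 γ) := by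
    intro j
    have : βM j = fun x => β0 j + r j x := funext (hsplit j)
    rw [this]
    exact continuousOn_const.add (hcont j)
  exact Step.couplingTrajectory_exists βM hγ0 hb hbβ hcontM hL hU

end Literature.MathematicalPhysics.QuantumFieldTheory.Balaban1983to89.B12Beta
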